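import Mathlib
import HarnessLib
import Summits.ResolutionOfSingularities.ResolutionOfSingularities.Theorems.WildQuotientsWildQuotientResolutionS1aQhSymChartNorms

/-!
# S1a — R4c cusp, brick (b5-norms): the chart-level NORMS `N(y′)`, `N(h_Q)` are `τ′`-FIXED (one moving generator, ✓QhRoot datum at `Q`)

[OURS · L1 W4.5c · lead-1 g17; plan-1 RULING R-F15v (2) ★ R4c `cusp_killsIn_two`, memo `Cruxes/CyclicQuotientFourfolds/Lines/s1a_logminvertex-R4c-PROGRESS.md` §2/§4: on the
`Q`-side producer charts `[N(y)]`, `[v]` the member charts invert `q·b′` with `b′` built from `N(y′) = ∏ₗ(y′ + l·x_none^sh x′₀)` and `N(h_Q) = ∏ₗ h_l`,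
`h_l = 2(1−3a)(y′ + l c) + 2x_none v′ − 3x_none(y′ + l c)²` (`c = x_none^sh x′₀`); rows ✓`QhAway.qhc_rows_fixed` / `qhc_row_one` (`v′ = x′₂` FIXED); tool
✓`QhSym.prod_shift_fixed`] — NOT statements of the manuscript; counted 0; AI-level work, weaker than expert review. Crux stmt-ResolutionOfSingularities-17941
`CyclicQuotientFourfolds`, line `s1a-logminvertex` v13 (`stub_reachLowerInFX`).
-/

set_option linter.dupNamespace false

noncomputable section

open MvPolynomial
open Literature.AlgebraicGeometry.Resolution
open scoped LaurentPolynomial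
open Summit.ResolutionOfSingularities.ResolutionOfSingularities.Theorems.WildQuotientResolution.S1
open Summit.ResolutionOfSingularities.ResolutionOfSingularities.Theorems.WildQuotientResolution.S1.CoarseChart
open Summit.ResolutionOfSingularities.ResolutionOfSingularities.Theorems.WildQuotientResolution.S1.ProducerStep
open Summit.ResolutionOfSingularities.ResolutionOfSingularities.Theorems.WildQuotientResolution.S1.ReesBigrading
open Summit.ResolutionOfSingularities.ResolutionOfSingularities.Theorems.WildQuotientResolution.S1.NodeTransport
open Summit.ResolutionOfSingularities.ResolutionOfSingularities.Theorems.WildQuotientResolution.S1.CobordantTransport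
open Summit.ResolutionOfSingularities.ResolutionOfSingularities.Theorems.WildQuotientResolution.S1.NodeAway
open Summit.ResolutionOfSingularities.ResolutionOfSingularities.Theorems.WildQuotientResolution.S1.CentreAway
open Summit.ResolutionOfSingularities.ResolutionOfSingularities.Theorems.WildQuotientResolution.S1.BlowupCharts
open Summit.ResolutionOfSingularities.ResolutionOfSingularities.Theorems.WildQuotientResolution.S1.KillCert
open Summit.ResolutionOfSingularities.ResolutionOfSingularities.Theorems.WildQuotientResolution.S1.GameFrame.GModel

namespace Summit.ResolutionOfSingularities.ResolutionOfSingularities.Theorems.WildQuotientResolution.S1.KillCert.QhAway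

variable {k : Type} [Field k] (σ : (MvPolynomial (Fin 4) k) ≃+* (MvPolynomial (Fin 4) k)) (hC : ∀ a : k, σ (C a) = C a)
  (h0 : σ (X 0) = X 0) (h1 : σ (X 1) = X 1 + X 0) (h2 : σ (X 2) = X 2) (t₀ : (MvPolynomial (Fin 4) k)) (h3 : σ (X 3) = X 3 + t₀)
  (w : Fin 3 → ℕ) (sh : ℕ) (hw0 : w 0 = w 1 + sh) (hh : (MvPolynomial (Fin 4) k)) (hσh : σ hh = hh)
  {p : ℕ} (hp : 0 < p) (hσpL : ∀ y : (Localization.Away hh), (⇑(sigmaAway σ hσh))^[p] y = y)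
  (hσJ : ∀ n : ℕ, ((weightedFiltration (fun i => algebraMap (MvPolynomial (Fin 4) k) (Localization.Away hh) (X ((![0, 1, 2] : Fin 3 → Fin 4) i))) w).ideal n).map ((sigmaAway σ hσh) : (Localization.Away hh) →+* (Localization.Away hh)) ≤ (weightedFiltration (fun i => algebraMap (MvPolynomial (Fin 4) k) (Localization.Away hh) (X ((![0, 1, 2] : Fin 3 → Fin 4) i))) w).ideal n)
  {mg : ℕ} (mo : Fin mg → ℕ) (𝒜 : (Π j : Fin mg, ZMod (mo j)) → AddSubgroup (Localization.Away hh)) [GradedRing 𝒜]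
  {dbar : ℕ} (y : ↥(𝒜 0)) (hy : y ∈ (traceFiltration 𝒜 (fun i => algebraMap (MvPolynomial (Fin 4) k) (Localization.Away hh) (X ((![0, 1, 2] : Fin 3 → Fin 4) i))) w).ideal dbar) (hσy : (sigmaAway σ hσh) (y : (Localization.Away hh)) = y)
  {P : Type} [CommRing P] [Algebra (MvPolynomial (Option (Fin 4)) k) P] (Φ : (ChartRing 𝒜 (fun i => algebraMap (MvPolynomial (Fin 4) k) (Localization.Away hh) (X ((![0, 1, 2] : Fin 3 → Fin 4) i))) w dbar y hy) ≃+* P)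
  (hΦa : ∀ a : (MvPolynomial (Fin 4) k), Φ ((algebraMap ↥(cobordantAlgebra (fun i => algebraMap (MvPolynomial (Fin 4) k) (Localization.Away hh) (X ((![0, 1, 2] : Fin 3 → Fin 4) i))) w) (ChartRing 𝒜 (fun i => algebraMap (MvPolynomial (Fin 4) k) (Localization.Away hh) (X ((![0, 1, 2] : Fin 3 → Fin 4) i))) w dbar y hy)) (algebraMap (Localization.Away hh) ↥(cobordantAlgebra (fun i => algebraMap (MvPolynomial (Fin 4) k) (Localization.Away hh) (X ((![0, 1, 2] : Fin 3 → Fin 4) i))) w) (algebraMap (MvPolynomial (Fin 4) k) (Localization.Away hh) a))) = (algebraMap (MvPolynomial (Option (Fin 4)) k) P) (cobordantAlgebra.subst k (![w 0, w 1, w 2, 0] : Fin 4 → ℕ) a))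
  (hΦs : Φ ((algebraMap ↥(cobordantAlgebra (fun i => algebraMap (MvPolynomial (Fin 4) k) (Localization.Away hh) (X ((![0, 1, 2] : Fin 3 → Fin 4) i))) w) (ChartRing 𝒜 (fun i => algebraMap (MvPolynomial (Fin 4) k) (Localization.Away hh) (X ((![0, 1, 2] : Fin 3 → Fin 4) i))) w dbar y hy)) (cobordantAlgebra.s (fun i => algebraMap (MvPolynomial (Fin 4) k) (Localization.Away hh) (X ((![0, 1, 2] : Fin 3 → Fin 4) i))) w)) = (algebraMap (MvPolynomial (Option (Fin 4)) k) P) (X none))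
  (hΦu : ∀ i : Fin 3, Φ ((algebraMap ↥(cobordantAlgebra (fun i => algebraMap (MvPolynomial (Fin 4) k) (Localization.Away hh) (X ((![0, 1, 2] : Fin 3 → Fin 4) i))) w) (ChartRing 𝒜 (fun i => algebraMap (MvPolynomial (Fin 4) k) (Localization.Away hh) (X ((![0, 1, 2] : Fin 3 → Fin 4) i))) w dbar y hy)) (cobordantAlgebra.u' (fun i => algebraMap (MvPolynomial (Fin 4) k) (Localization.Away hh) (X ((![0, 1, 2] : Fin 3 → Fin 4) i))) w i)) = (algebraMap (MvPolynomial (Option (Fin 4)) k) P) (X (some ((![0, 1, 2] : Fin 3 → Fin 4) i))))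

set_option maxHeartbeats 1600000 in
include h0 h1 h2 h3 hC hw0 hΦa hΦs hΦu in
/-- **`N(y′) = ∏ₗ (x′₁ + l·x_none^sh x′₀)` is `τ′`-fixed** (one moving generator). [OURS · L1 W4.5c · R4c] -/
theorem qhc_normX1_fixed [NeZero p] [CharP P p] (hp1 : p ≠ 1) :
    conj Φ (sigmaChart 𝒜 (fun i => algebraMap (MvPolynomial (Fin 4) k) (Localization.Away hh) (X ((![0, 1, 2] : Fin 3 → Fin 4) i))) w dbar y hy (sigmaAway σ hσh) hσJ hp hσpL hσy) ((algebraMap (MvPolynomial (Option (Fin 4)) k) P) (∏ i : ZMod p, (X (some 1) + (i.val : (MvPolynomial (Option (Fin 4)) k)) * (X none ^ sh * X (some 0))))) =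
      (algebraMap (MvPolynomial (Option (Fin 4)) k) P) (∏ i : ZMod p, (X (some 1) + (i.val : (MvPolynomial (Option (Fin 4)) k)) * (X none ^ sh * X (some 0)))) := by
  obtain ⟨rn, r0, -, -⟩ := qhc_rows_fixed σ hC h0 h1 h2 t₀ h3 w hh hσh hp hσpL hσJ mo 𝒜 y hy hσy Φ hΦa hΦs hΦu
  have r1 := qhc_row_one σ h0 h1 h2 t₀ h3 w sh hw0 hh hσh hp hσpL hσJ mo 𝒜 y hy hσy Φ hΦs hΦu
  rw [map_prod]
  refine QhSym.prod_shift_fixed (conj Φ (sigmaChart 𝒜 (fun i => algebraMap (MvPolynomial (Fin 4) k) (Localization.Away hh) (X ((![0, 1, 2] : Fin 3 → Fin 4) i))) w dbar y hy (sigmaAway σ hσh) hσJ hp hσpL hσy)) _ fun i => ?_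
  simp only [map_add, map_mul, map_pow, map_natCast, r1, rn, r0, QhSym.natCast_val_add_one hp1]
  ring

set_option maxHeartbeats 1600000 in
include h0 h1 h2 h3 hC hw0 hΦa hΦs hΦu in
/-- **`N(h_Q) = ∏ₗ h_l` is `τ′`-fixed**, `h_l = C e·(x′₁ + l·c) + 2x_none x′₂ − 3x_none(x′₁ + l·c)²` (`c = x_none^sh x′₀`, `e = 2(1−3a)`; `h₀ = h_Q`, the member-row unit
at `Q`; `x′₂ = v′` is fixed). [OURS · L1 W4.5c · R4c] -/
theorem qhc_normHQ_fixed [NeZero p] [CharP P p] (hp1 : p ≠ 1) (e : k) :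
    conj Φ (sigmaChart 𝒜 (fun i => algebraMap (MvPolynomial (Fin 4) k) (Localization.Away hh) (X ((![0, 1, 2] : Fin 3 → Fin 4) i))) w dbar y hy (sigmaAway σ hσh) hσJ hp hσpL hσy) ((algebraMap (MvPolynomial (Option (Fin 4)) k) P) (∏ i : ZMod p, (C e * (X (some 1) + (i.val : (MvPolynomial (Option (Fin 4)) k)) * (X none ^ sh * X (some 0))) + 2 * X none * X (some 2) -
        3 * X none * (X (some 1) + (i.val : (MvPolynomial (Option (Fin 4)) k)) * (X none ^ sh * X (some 0))) ^ 2))) =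
      (algebraMap (MvPolynomial (Option (Fin 4)) k) P) (∏ i : ZMod p, (C e * (X (some 1) + (i.val : (MvPolynomial (Option (Fin 4)) k)) * (X none ^ sh * X (some 0))) + 2 * X none * X (some 2) -
        3 * X none * (X (some 1) + (i.val : (MvPolynomial (Option (Fin 4)) k)) * (X none ^ sh * X (some 0))) ^ 2)) := by
  obtain ⟨rn, r0, r2, rC⟩ := qhc_rows_fixed σ hC h0 h1 h2 t₀ h3 w hh hσh hp hσpL hσJ mo 𝒜 y hy hσy Φ hΦa hΦs hΦu
  have r1 := qhc_row_one σ h0 h1 h2 t₀ h3 w sh hw0 hh hσh hp hσpL hσJ mo 𝒜 y hy hσy Φ hΦs hΦu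
  rw [map_prod]
  refine QhSym.prod_shift_fixed (conj Φ (sigmaChart 𝒜 (fun i => algebraMap (MvPolynomial (Fin 4) k) (Localization.Away hh) (X ((![0, 1, 2] : Fin 3 → Fin 4) i))) w dbar y hy (sigmaAway σ hσh) hσJ hp hσpL hσy)) _ fun i => ?_
  simp only [map_sub, map_add, map_mul, map_pow, map_natCast, map_ofNat, r1, r2, rn, r0, rC, QhSym.natCast_val_add_one hp1]
  ring

end Summit.ResolutionOfSingularities.ResolutionOfSingularities.Theorems.WildQuotientResolution.S1.KillCert.QhAway

end
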